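import Literature.ModelTheory.ExponentialFields.SemialgebraicClusterSets
import Literature.ModelTheory.ExponentialFields.SemialgebraicC1Cells
import Literature.NumberTheory.Transcendental.SemialgebraicMonotonicityDefinable
import HarnessLib

/-!
# Generic smoothness and small exceptional sets

Topic `Literature/ModelTheory/ExponentialFields` — block B4₂ of the proof of the
`C¹`-triangulation theorem for compact semialgebraic sets
(`Literature.ModelTheory.ExponentialFields.OhmotoShiota2017_c1Triangulation`, statement of
[OhmotoShiota2017, Thm. 1.1]) along the proof of [Pawlucki2024], specialized to `p = 1`.

Bookkeeping for the "closed nowhere dense exceptional sets" of [Pawlucki2024, Thm. 5.3,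
Lemma 5.4]: `IsSmall Z` (`Z = ∅ ∨ dim Z < m`), stable under subsets, finite unions and closure;
a semialgebraic function on an open semialgebraic set is `C¹` off a closed small semialgebraic set
([Dries1998, Ch. 7 (3.2)], from the `C¹` cell decomposition); and the limit function
`g(a) = lim_{t → 0⁺} f(a, t)` of a semialgebraic `f` is semialgebraic (first-order formula).

No named facts are introduced (D-0026).

## References

* [Pawlucki2024] W. Pawłucki, *Strict `C^p`-triangulations …*, J. Eur. Math. Soc. 26 (2024), §5.3.
* [Dries1998] L. van den Dries, *Tame topology and o-minimal structures*, Ch. 4 (1.8), Ch. 7 (3.2).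
-/

noncomputable section

open Set Filter Metric
open _root_.Topology

namespace Literature.ModelTheory.ExponentialFields

open Literature.NumberTheory.Transcendental (IsSemialgebraicFunOn IsSemialgebraicMapOn
  isSemialgebraicFunOn_iff)
open Literature.NumberTheory.Transcendental.SemialgebraicMonotonicity (sa_and sa_imp sa_not
  sa_lt sa_eq sa_const_lt sa_lt_const sa_exists_snoc sa_forall_snoc)

section Small

variable {m : ℕ}

/-- **Small sets**: empty or of dimension `< m` (for semialgebraic sets: nowhere dense).
[cite: Dries1998, Ch. 4 (1.8)] -/
def IsSmall (Z : Set (Fin m → ℝ)) : Prop := Z = ∅ ∨ sdim Z < m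

/-- The empty set is small. [cite: Dries1998, Ch. 4 (1.8)] -/
theorem isSmall_empty : IsSmall (∅ : Set (Fin m → ℝ)) := Or.inl rfl

/-- Subsets of small sets are small. [cite: Dries1998, Ch. 4 (1.8)] -/
theorem IsSmall.mono {Z Z' : Set (Fin m → ℝ)} (h : IsSmall Z) (hsub : Z' ⊆ Z) : IsSmall Z' := by
  rcases h with h | h
  · exact Or.inl (subset_eq_empty hsub h)
  · exact Or.inr ((sdim_mono hsub).trans_lt h)

/-- Finite unions of small semialgebraic sets are small. [cite: Dries1998, Ch. 4 (1.8)] -/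
theorem IsSmall.union {Z Z' : Set (Fin m → ℝ)} (h : IsSmall Z) (h' : IsSmall Z') (hZ : IsSemialgebraic ℝ Z)
    (hZ' : IsSemialgebraic ℝ Z') : IsSmall (Z ∪ Z') := by
  rcases h with h | h
  · rw [h, empty_union]; exact h'
  rcases h' with h' | h'
  · rw [h', union_empty]; exact Or.inr h
  · exact Or.inr (by rw [sdim_union hZ hZ']; exact max_lt h h')

/-- The closure of a small semialgebraic set is small. [cite: Dries1998, Ch. 4 (1.8)] -/
theorem IsSmall.closure {Z : Set (Fin m → ℝ)} (h : IsSmall Z) (hZ : IsSemialgebraic ℝ Z) : IsSmall (closure Z) := by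
  rcases h with h | h
  · left; rw [h, closure_empty]
  · right; rwa [sdim_closure hZ]

/-- A nonempty open set is not contained in a small set. [cite: Dries1998, Ch. 4 (1.8)] -/
theorem exists_mem_not_mem_of_isSmall {Z U : Set (Fin m → ℝ)} (h : IsSmall Z) (hU : IsOpen U) (hne : U.Nonempty) :
    ∃ x ∈ U, x ∉ Z := by
  by_contra hall
  push Not at hall
  have hsub : U ⊆ Z := hall
  rcases h with h | h
  · rw [h] at hsub; exact absurd (subset_eq_empty hsub rfl) hne.ne_empty
  · have hint : (interior Z).Nonempty := (hne.mono (interior_maximal hsub hU))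
    have := sdim_eq_of_interior_nonempty hint
    omega

/-- Small closed sets have dense open complement inside any open set: every point of an open `G` is
a limit of points of `G ∖ Z`. [cite: Dries1998, Ch. 4 (1.8)] -/
theorem closure_diff_of_isSmall {Z G : Set (Fin m → ℝ)} (h : IsSmall Z) (hG : IsOpen G) : G ⊆ closure (G \ Z) := by
  intro x hx
  rw [Metric.mem_closure_iff]
  intro ε hε
  obtain ⟨y, hy, hyZ⟩ := exists_mem_not_mem_of_isSmall h (hG.inter isOpen_ball) ⟨x, hx, mem_ball_self hε⟩
  exact ⟨y, ⟨hy.1, hyZ⟩, by rw [dist_comm]; exact mem_ball.1 hy.2⟩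

/-! ### Generic smoothness -/

/-- **A semialgebraic function on an open semialgebraic set is `C¹` off a closed small
semialgebraic set.** [cite: Dries1998, Ch. 7 (3.2)] -/
theorem exists_contDiffOn_off_small {G : Set (Fin m → ℝ)} (hG : IsOpen G)
    {g : (Fin m → ℝ) → ℝ} (hg : IsSemialgebraicFunOn ℝ G g) :
    ∃ Z : Set (Fin m → ℝ), IsSemialgebraic ℝ Z ∧ IsClosed Z ∧ IsSmall Z ∧ IsOpen (G \ Z) ∧ ContDiffOn ℝ 1 g (G \ Z) := by
  classical
  obtain ⟨𝒟, h𝒟, -, hcells, hC1⟩ := (c1_cell_decomposition m).2 Unit (fun _ => G) (fun _ => g) (fun _ => hg) ∅ (by simp)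
  -- the low-dimensional cells
  set ℒ := 𝒟.filter fun C => sdim C < m with hℒ
  set Z₀ : Set (Fin m → ℝ) := ⋃ C ∈ ℒ, C with hZ₀
  have hcellsa : ∀ C ∈ 𝒟, IsSemialgebraic ℝ C := fun C hC => h𝒟.1.isSemialgebraic C hC
  have hZ₀sa : IsSemialgebraic ℝ Z₀ := IsSemialgebraic.biUnion _ _ fun C hC => hcellsa C (Finset.mem_filter.1 hC).1
  have hZ₀small : IsSmall Z₀ := by
    rcases Nat.eq_zero_or_pos m with hm | hm
    · left
      apply eq_empty_of_forall_notMem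
      intro x hx
      obtain ⟨C, hC, -⟩ := mem_iUnion₂.1 hx
      have := (Finset.mem_filter.1 hC).2; omega
    · right
      have hle : sdim Z₀ ≤ m - 1 :=
        sdim_biUnion_le _ _ (fun C hC => hcellsa C (Finset.mem_filter.1 hC).1) fun C hC => by
          have := (Finset.mem_filter.1 hC).2; omega
      omega
  -- points of `G` off `Z₀` lie in open cells inside `G`
  have hopen : ∀ x ∈ G, x ∉ Z₀ → ∃ C ∈ 𝒟, x ∈ C ∧ C ⊆ G ∧ IsOpen C := by
    intro x hx hxZ
    obtain ⟨C, ⟨hC, hxC⟩, -⟩ := h𝒟.1.isPartition.2 x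
    have hCG : C ⊆ G := by
      rcases hcells () C hC with h | h
      · exact h
      · exact absurd hx (disjoint_left.1 h hxC)
    obtain ⟨d, hd⟩ := h𝒟.2 C hC
    have hdim : sdim C = d := hd.isSACell.sdim_eq
    have hdm : d = m := by
      by_contra hne
      have hlt : sdim C < m := by
        have := sdim_le C; omega
      exact hxZ (mem_iUnion₂.2 ⟨C, Finset.mem_filter.2 ⟨hC, hlt⟩, hxC⟩)
    exact ⟨C, hC, hxC, hCG, hd.isSACell.isOpen hdm⟩
  refine ⟨closure Z₀, isSemialgebraic_closure hZ₀sa, isClosed_closure, hZ₀small.closure hZ₀sa,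
    hG.sdiff isClosed_closure, ?_⟩
  refine contDiffOn_of_locally_contDiffOn fun x hx => ?_
  obtain ⟨C, hC, hxC, hCG, hCo⟩ := hopen x hx.1 fun h => hx.2 (subset_closure h)
  refine ⟨C, hCo, hxC, ?_⟩
  -- `g` is `C¹` on the open cell `C`
  obtain ⟨U, hU, hCU, F, hF, hFg⟩ := hC1 () C hC hCG
  have h : ContDiffOn ℝ 1 g C := (hF.mono hCU).congr fun y hy => (hFg hy).symm
  exact h.mono inter_subset_right

end Small

/-! ### The limit function at the bottom of a half-box is semialgebraic -/

section LimitFun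

variable {m : ℕ}

/-- Coordinates of `W = (a, v, ε, δ, t, u) ∈ ℝᵐ⁺⁵`. [folklore] -/
abbrev lfU (m : ℕ) : Fin (m + 5) := Fin.last (m + 4)
/-- coordinate `t`. [folklore] -/
abbrev lfT (m : ℕ) : Fin (m + 5) := (Fin.last (m + 3)).castSucc
/-- coordinate `δ`. [folklore] -/
abbrev lfD (m : ℕ) : Fin (m + 5) := (Fin.last (m + 2)).castSucc.castSucc
/-- coordinate `ε`. [folklore] -/
abbrev lfE (m : ℕ) : Fin (m + 5) := (Fin.last (m + 1)).castSucc.castSucc.castSucc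
/-- coordinate `v`. [folklore] -/
abbrev lfV (m : ℕ) : Fin (m + 5) := (Fin.last m).castSucc.castSucc.castSucc.castSucc
/-- base coordinates `a`. [folklore] -/
abbrev lfA (m : ℕ) (l : Fin m) : Fin (m + 5) := l.castSucc.castSucc.castSucc.castSucc.castSucc

/-- The matrix vector from `w = (a, v)` and `ε, δ, t, u`. [folklore] -/
def lfW (w : Fin (m + 1) → ℝ) (ε δ t u : ℝ) : Fin (m + 5) → ℝ :=
  Fin.snoc (Fin.snoc (Fin.snoc (Fin.snoc w ε : Fin (m + 2) → ℝ) δ : Fin (m + 3) → ℝ) t : Fin (m + 4) → ℝ) u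

/-- `W` at `u`. [folklore] -/
@[simp] theorem lfW_U (w : Fin (m + 1) → ℝ) (ε δ t u : ℝ) : lfW w ε δ t u (lfU m) = u := by simp [lfW, lfU]
/-- `W` at `t`. [folklore] -/
@[simp] theorem lfW_T (w : Fin (m + 1) → ℝ) (ε δ t u : ℝ) : lfW w ε δ t u (lfT m) = t := by simp [lfW, lfT]
/-- `W` at `δ`. [folklore] -/
@[simp] theorem lfW_D (w : Fin (m + 1) → ℝ) (ε δ t u : ℝ) : lfW w ε δ t u (lfD m) = δ := by simp [lfW, lfD]
/-- `W` at `ε`. [folklore] -/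
@[simp] theorem lfW_E (w : Fin (m + 1) → ℝ) (ε δ t u : ℝ) : lfW w ε δ t u (lfE m) = ε := by simp [lfW, lfE]
/-- `W` at `v`. [folklore] -/
@[simp] theorem lfW_V (w : Fin (m + 1) → ℝ) (ε δ t u : ℝ) : lfW w ε δ t u (lfV m) = w (Fin.last m) := by simp [lfW, lfV]
/-- `W` at the base. [folklore] -/
@[simp] theorem lfW_A (w : Fin (m + 1) → ℝ) (ε δ t u : ℝ) (l : Fin m) : lfW w ε δ t u (lfA m l) = w l.castSucc := by
  simp [lfW, lfA]

/-- `W ∘ lfA = init w`. [folklore] -/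
theorem lfW_comp_lfA (w : Fin (m + 1) → ℝ) (ε δ t u : ℝ) : lfW w ε δ t u ∘ lfA m = Fin.init w := by
  funext l; simp [Fin.init]

/-- A one-sided limit at `0⁺` in `ε`–`δ` form. [folklore] -/
theorem tendsto_nhdsGT_zero_iff {φ : ℝ → ℝ} {v η : ℝ} (hη : 0 < η) :
    Tendsto φ (𝓝[>] 0) (𝓝 v) ↔ ∀ ε : ℝ, 0 < ε → ∃ δ : ℝ, 0 < δ ∧ ∀ t : ℝ, 0 < t → t < δ → t < η → (φ t - v) ^ 2 < ε ^ 2 := by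
  rw [Metric.tendsto_nhdsWithin_nhds]
  constructor
  · intro h ε hε
    obtain ⟨δ, hδ, h⟩ := h ε hε
    refine ⟨δ, hδ, fun t ht htδ _ => ?_⟩
    have h' := h ht (by rw [dist_zero_right, Real.norm_eq_abs, abs_of_pos ht]; exact htδ)
    rw [Real.dist_eq] at h'
    have := abs_lt.1 h'
    nlinarith [this.1, this.2]
  · intro h ε hε
    obtain ⟨δ, hδ, h⟩ := h ε hε
    refine ⟨min δ η, lt_min hδ hη, fun t ht htd => ?_⟩
    rw [dist_zero_right, Real.norm_eq_abs, abs_of_pos ht] at htd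
    have h' := h t ht (htd.trans_le (min_le_left _ _)) (htd.trans_le (min_le_right _ _))
    rw [Real.dist_eq, ← abs_of_pos hε, ← sq_lt_sq]
    exact h'

/-- **The limit function is semialgebraic**: if `t ↦ f (a, t)` tends to `g a` as `t → 0⁺` for every
`a ∈ G'`, with `f` semialgebraic on the half-box `G × (0, η)` and `G' ⊆ G` semialgebraic, then `g` is
semialgebraic on `G'`. [cite: Pawlucki2024, Thm. 5.3 (proof, (5.3.1))] -/
theorem isSemialgebraicFunOn_lim {G G' : Set (Fin m → ℝ)} (hG' : IsSemialgebraic ℝ G') (hG'G : G' ⊆ G) {η : ℝ}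
    (hη : 0 < η) {f : (Fin (m + 1) → ℝ) → ℝ} (hf : IsSemialgebraicFunOn ℝ (halfBox G η) f) {g : (Fin m → ℝ) → ℝ}
    (hlim : ∀ a ∈ G', Tendsto (fun t => f (Fin.snoc a t)) (𝓝[>] 0) (𝓝 (g a))) : IsSemialgebraicFunOn ℝ G' g := by
  have hΓ : IsSemialgebraic ℝ {z : Fin (m + 1 + 1) → ℝ | Fin.init z ∈ halfBox G η ∧ z (Fin.last (m + 1)) = f (Fin.init z)} :=
    isSemialgebraicFunOn_iff.mp hf
  -- the matrix on `W = (a, v, ε, δ, t, u)`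
  set M : Set (Fin (m + 5) → ℝ) := {W |
    (0 < W (lfT m) ∧ W (lfT m) < W (lfD m) ∧ W (lfT m) < η ∧
      ((Fin.snoc (W ∘ lfA m) (W (lfT m)) : Fin (m + 1) → ℝ) ∈ halfBox G η ∧
        W (lfU m) = f (Fin.snoc (W ∘ lfA m) (W (lfT m))))) →
      (W (lfU m) - W (lfV m)) ^ 2 < W (lfE m) ^ 2} with hM
  have hMsa : IsSemialgebraic ℝ M := by
    refine sa_imp (sa_and (sa_const_lt _ _) (sa_and (sa_lt _ _) (sa_and (sa_lt_const _ _) ?_))) ?_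
    · have h := hΓ.preimage_comp (Fin.snoc (Fin.snoc (lfA m) (lfT m)) (lfU m))
      refine (show {W : Fin (m + 5) → ℝ | _} = _ from ?_) ▸ h
      ext W; simp [Fin.comp_snoc]
    · have h := isSemialgebraic_setOf_eval_lt (k := ℝ) (R := ℝ)
        ((MvPolynomial.X (lfU m) - MvPolynomial.X (lfV m)) ^ 2 : MvPolynomial (Fin (m + 5)) ℝ) (MvPolynomial.X (lfE m) ^ 2)
      refine (show {W : Fin (m + 5) → ℝ | _} = _ from ?_) ▸ h
      ext W; simp
  -- quantifiers: `∀ u`, `∀ t`, `∃ δ > 0`, `∀ ε > 0`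
  have h4 : IsSemialgebraic ℝ {W : Fin (m + 4) → ℝ | ∀ u : ℝ, (Fin.snoc W u : Fin (m + 5) → ℝ) ∈ M} :=
    sa_forall_snoc (n := m + 4) hMsa
  have h3 : IsSemialgebraic ℝ {W : Fin (m + 3) → ℝ | ∀ t u : ℝ, (Fin.snoc (Fin.snoc W t : Fin (m + 4) → ℝ) u : Fin (m + 5) → ℝ) ∈ M} :=
    sa_forall_snoc (n := m + 3) h4
  have h2 : IsSemialgebraic ℝ {W : Fin (m + 2) → ℝ | ∃ δ : ℝ, 0 < δ ∧ ∀ t u : ℝ,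
      (Fin.snoc (Fin.snoc (Fin.snoc W δ : Fin (m + 3) → ℝ) t : Fin (m + 4) → ℝ) u : Fin (m + 5) → ℝ) ∈ M} := by
    have h3' : IsSemialgebraic ℝ {W : Fin (m + 3) → ℝ | 0 < W (Fin.last (m + 2)) ∧ ∀ t u : ℝ,
        (Fin.snoc (Fin.snoc W t : Fin (m + 4) → ℝ) u : Fin (m + 5) → ℝ) ∈ M} := (sa_const_lt _ _).inter h3
    have h := sa_exists_snoc (n := m + 2) h3'
    convert h using 1; ext W; simp
  have h1 : IsSemialgebraic ℝ {w : Fin (m + 1) → ℝ | ∀ ε : ℝ, 0 < ε → ∃ δ : ℝ, 0 < δ ∧ ∀ t u : ℝ, lfW w ε δ t u ∈ M} := by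
    have h2' : IsSemialgebraic ℝ {W : Fin (m + 2) → ℝ | 0 < W (Fin.last (m + 1)) → ∃ δ : ℝ, 0 < δ ∧ ∀ t u : ℝ,
        (Fin.snoc (Fin.snoc (Fin.snoc W δ : Fin (m + 3) → ℝ) t : Fin (m + 4) → ℝ) u : Fin (m + 5) → ℝ) ∈ M} :=
      sa_imp (sa_const_lt _ _) h2
    have h := sa_forall_snoc (n := m + 1) h2'
    convert h using 1; ext w; simp [lfW]
  have hMiff : ∀ (w : Fin (m + 1) → ℝ) (ε δ t u : ℝ), lfW w ε δ t u ∈ M ↔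
      ((0 < t ∧ t < δ ∧ t < η ∧ ((Fin.snoc (Fin.init w) t : Fin (m + 1) → ℝ) ∈ halfBox G η ∧ u = f (Fin.snoc (Fin.init w) t))) →
        (u - w (Fin.last m)) ^ 2 < ε ^ 2) := by
    intro w ε δ t u
    simp only [hM, mem_setOf_eq, lfW_comp_lfA, lfW_U, lfW_T, lfW_D, lfW_E, lfW_V]
  rw [isSemialgebraicFunOn_iff]
  have hkey : {w : Fin (m + 1) → ℝ | Fin.init w ∈ G' ∧ w (Fin.last m) = g (Fin.init w)} =
      {w | (Fin.init w : Fin m → ℝ) ∈ G'} ∩ {w | ∀ ε : ℝ, 0 < ε → ∃ δ : ℝ, 0 < δ ∧ ∀ t u : ℝ, lfW w ε δ t u ∈ M} := by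
    ext w
    simp only [mem_setOf_eq, mem_inter_iff]
    refine ⟨fun ⟨ha, hv⟩ => ⟨ha, ?_⟩, fun ⟨ha, H⟩ => ⟨ha, ?_⟩⟩
    · intro ε hε
      have ht := (tendsto_nhdsGT_zero_iff hη).1 (hlim _ ha) ε hε
      obtain ⟨δ, hδ, h⟩ := ht
      refine ⟨δ, hδ, fun t u => (hMiff w ε δ t u).2 ?_⟩
      rintro ⟨ht0, htδ, htη, -, rfl⟩
      rw [hv]; exact h t ht0 htδ htη
    · have ht : Tendsto (fun t => f (Fin.snoc (Fin.init w) t)) (𝓝[>] 0) (𝓝 (w (Fin.last m))) := by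
        refine (tendsto_nhdsGT_zero_iff hη).2 fun ε hε => ?_
        obtain ⟨δ, hδ, h⟩ := H ε hε
        refine ⟨δ, hδ, fun t ht0 htδ htη => ?_⟩
        exact (hMiff w ε δ t _).1 (h t _) ⟨ht0, htδ, htη, snoc_mem_halfBox.2 ⟨hG'G ha, ht0, htη⟩, rfl⟩
      exact tendsto_nhds_unique ht (hlim _ ha)
  rw [hkey]
  exact hG'.setOf_init_mem.inter h1

end LimitFun

end Literature.ModelTheory.ExponentialFields
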